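import Summits.FinalStateConjecture.FinalStateConjecture.Theorems.UniformPhotonSphereChannels.Negative.CensusStep

/-!
# Crux `UniformPhotonSphereChannels` (K1), negative side — kernel census (conclusion) and the
# near-side lower bound for the kernel deficit

Support file of the standing disprover of item stmt-FinalStateConjecture-10045.

* `static_of_finite_energy`: an element of the candidate kernel `P(ρ)` (a `C²` `t`-polynomial
  solution on the exterior cone) whose energy at `t = 0` on the near half-line `(−∞, e₀)`,
  `e₀ = x_c − ρ`, is finite, is STATIC on the near cone `{x + |t| < e₀}`: `p(t, x) = p(0, x)`.
  (Induction on the number of coefficients with `CensusStep.top_coeff_eq_zero`.)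
* `near_deficit_lower_bound`: consequently, for a global `C²` field `ψ` with EVEN data
  `ψ(0,·) = g ∈ C²_c`, `ψ_t(0,·) = 0`, and any kernel element `p`, the near part of the exterior
  energy of `ψ − p` at `t = 0` is at least `∫_{s₁}^{s₂} (g'² + V g²)` whenever `g(s₁) = g(s₂) = 0`,
  `s₂ < e₀`: the cross term `∫ (g' p₀' + V g p₀)` vanishes by parts since `p₀'' = V p₀`.
  This is the lower bound `dist²(data, P(ρ)) ≥ E₀` of the refutation. [folklore]
-/

namespace Summit.FinalStateConjecture.FinalStateConjecture.Theorems

open MeasureTheory Set Filter Topology Finset intervalIntegral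

noncomputable section

namespace KernelCensus

open WaveEnergy

variable {V : ℝ → ℝ} {e₀ : ℝ} {p : ℝ → ℝ → ℝ}

/-- **Kernel census.**  A `C²` `t`-polynomial solution on the near cone with finite near energy at
`t = 0` is static there. -/
theorem static_of_finite_energy (hV : ContDiff ℝ 1 V) (hV0 : ∀ x, 0 ≤ V x) {C κ : ℝ} (hκ : 0 < κ)
    (hC : 0 ≤ C) (hVexp : ∀ x < e₀, V x ≤ C * Real.exp (κ * x))
    (hp : ContDiffOn ℝ 2 (Function.uncurry p) {z : ℝ × ℝ | z.2 + |z.1| < e₀})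
    (hsol : ∀ z : ℝ × ℝ, z.2 + |z.1| < e₀ →
      iteratedDeriv 2 (fun τ => p τ z.2) z.1 - iteratedDeriv 2 (p z.1) z.2 + V z.2 * p z.1 z.2 = 0)
    (hpoly : ∃ (N : ℕ) (a : ℕ → ℝ → ℝ), ∀ z : ℝ × ℝ, z.2 + |z.1| < e₀ →
      p z.1 z.2 = ∑ i ∈ range N, a i z.2 * z.1 ^ i)
    (hfin : ∫⁻ x in Iio e₀, ENNReal.ofReal
      (deriv (fun τ => p τ x) 0 ^ 2 + deriv (p 0) x ^ 2 + V x * p 0 x ^ 2) < ⊤) :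
    ∀ z : ℝ × ℝ, z.2 + |z.1| < e₀ → p z.1 z.2 = p 0 z.2 := by
  -- normalise the coefficients to vanish from `N` on
  obtain ⟨N, a, ha⟩ := hpoly
  set b : ℕ → ℝ → ℝ := fun i => if i < N then a i else fun _ => 0 with hb
  have hb_rep : ∀ z : ℝ × ℝ, z.2 + |z.1| < e₀ → p z.1 z.2 = ∑ i ∈ range N, b i z.2 * z.1 ^ i := by
    intro z hz
    rw [ha z hz]
    exact sum_congr rfl fun i hi => by simp [hb, mem_range.mp hi]
  have hb_van : ∀ i, N ≤ i → ∀ x < e₀, b i x = 0 := fun i hi x _ => by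
    simp [hb, not_lt.mpr hi]
  -- induction on the number of coefficients
  have aux : ∀ (n : ℕ) (c : ℕ → ℝ → ℝ),
      (∀ z : ℝ × ℝ, z.2 + |z.1| < e₀ → p z.1 z.2 = ∑ i ∈ range n, c i z.2 * z.1 ^ i) →
      (∀ i, n ≤ i → ∀ x < e₀, c i x = 0) →
      ∀ z : ℝ × ℝ, z.2 + |z.1| < e₀ → p z.1 z.2 = p 0 z.2 := by
    intro n
    induction n with
    | zero =>
      intro c hc _ z hz
      have hz0 : z.2 + |(0 : ℝ)| < e₀ := by
        rw [abs_zero, add_zero]; linarith [abs_nonneg z.1]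
      rw [hc z hz, hc (0, z.2) hz0]
      simp
    | succ n ih =>
      intro c hc hvan z hz
      rcases Nat.eq_zero_or_pos n with hn | hn
      · subst hn
        have hz0 : z.2 + |(0 : ℝ)| < e₀ := by
          rw [abs_zero, add_zero]; linarith [abs_nonneg z.1]
        rw [hc z hz, hc (0, z.2) hz0]
        simp
      · have htop := top_coeff_eq_zero hV hV0 hκ hC hVexp hp hsol hn hc hvan hfin
        refine ih c (fun w hw => ?_) (fun i hi x hx => ?_) z hz
        · have hw2 : w.2 < e₀ := by linarith [abs_nonneg w.1]
          rw [hc w hw, sum_range_succ, htop w.2 hw2]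
          simp
        · rcases eq_or_lt_of_le hi with h | h
          · rw [← h]; exact htop x hx
          · exact hvan i h x hx
  exact aux N b hb_rep hb_van

variable {ψ : ℝ → ℝ → ℝ} {g : ℝ → ℝ}

/-- **Near-side lower bound for the kernel deficit (even data).**  See the module docstring. -/
theorem near_deficit_lower_bound (hV : ContDiff ℝ 1 V) (hV0 : ∀ x, 0 ≤ V x) {C κ : ℝ}
    (hκ : 0 < κ) (hC : 0 ≤ C) (hVexp : ∀ x < e₀, V x ≤ C * Real.exp (κ * x))
    (hψ : ContDiff ℝ 2 (Function.uncurry ψ)) (hg : ContDiff ℝ 2 g) (hgc : HasCompactSupport g)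
    (h0 : ∀ x, ψ 0 x = g x) (h1 : ∀ x, deriv (fun τ => ψ τ x) 0 = 0)
    {s₁ s₂ : ℝ} (hs : s₁ ≤ s₂) (hs₂ : s₂ < e₀) (hg₁ : g s₁ = 0) (hg₂ : g s₂ = 0)
    (hp : ContDiffOn ℝ 2 (Function.uncurry p) {z : ℝ × ℝ | z.2 + |z.1| < e₀})
    (hsol : ∀ z : ℝ × ℝ, z.2 + |z.1| < e₀ →
      iteratedDeriv 2 (fun τ => p τ z.2) z.1 - iteratedDeriv 2 (p z.1) z.2 + V z.2 * p z.1 z.2 = 0)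
    (hpoly : ∃ (N : ℕ) (a : ℕ → ℝ → ℝ), ∀ z : ℝ × ℝ, z.2 + |z.1| < e₀ →
      p z.1 z.2 = ∑ i ∈ range N, a i z.2 * z.1 ^ i) :
    ENNReal.ofReal (∫ x in s₁..s₂, deriv g x ^ 2 + V x * g x ^ 2)
      ≤ ∫⁻ x in Iio e₀, ENNReal.ofReal
          (deriv (fun τ => ψ τ x - p τ x) 0 ^ 2 + deriv (fun y => ψ 0 y - p 0 y) x ^ 2
            + V x * (ψ 0 x - p 0 x) ^ 2) := by
  -- trivial if the near energy of `ψ − p` is infinite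
  by_cases hinf : ∫⁻ x in Iio e₀, ENNReal.ofReal
      (deriv (fun τ => ψ τ x - p τ x) 0 ^ 2 + deriv (fun y => ψ 0 y - p 0 y) x ^ 2
        + V x * (ψ 0 x - p 0 x) ^ 2) = ⊤
  · rw [hinf]; exact le_top
  -- slices of `ψ`
  have hψd := differentiable_of_contDiff_two hψ
  have hψ0 : ψ 0 = g := funext h0
  have hψt : ∀ x, HasDerivAt (fun τ => ψ τ x) 0 0 := by
    intro x
    have h := hasDerivAt_slice_fst hψd 0 x
    have h' : fderiv ℝ (Function.uncurry ψ) (0, x) (1, 0) = 0 := by rw [← h.deriv]; exact h1 x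
    simpa [h'] using h
  have hgd : ∀ x, HasDerivAt g (deriv g x) x := fun x => (hg.differentiable (by norm_num) x).hasDerivAt
  have hgc' : Continuous (deriv g) := hg.continuous_deriv (by norm_num)
  -- slices of `p` on the near cone
  obtain ⟨N, a, ha⟩ := hpoly
  have hpt : ∀ x < e₀, HasDerivAt (fun τ => p τ x) (deriv (fun τ => p τ x) 0) 0 := by
    intro x hx
    have hO : IsOpen {τ : ℝ | x + |τ| < e₀} := isOpen_lt (by fun_prop) continuous_const
    have hx0 : x + |(0 : ℝ)| < e₀ := by simpa using hx
    have hev : (fun τ => p τ x) =ᶠ[𝓝 0] fun τ => ∑ i ∈ range N, a i x * τ ^ i := by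
      filter_upwards [hO.mem_nhds hx0] with τ hτ
      exact ha (τ, x) hτ
    have hpoly' : HasDerivAt (fun τ : ℝ => ∑ i ∈ range N, a i x * τ ^ i)
        (∑ i ∈ range N, a i x * ((i : ℝ) * (0 : ℝ) ^ (i - 1))) 0 :=
      HasDerivAt.fun_sum fun i _ => (hasDerivAt_pow i (0 : ℝ)).const_mul (a i x)
    have h := hpoly'.congr_of_eventuallyEq hev
    rwa [h.deriv]
  have hpx : ∀ x < e₀, HasDerivAt (p 0) (deriv (p 0) x) x := by
    intro x hx
    obtain ⟨u, -, hsl⟩ := exists_extension_slices hp (show 0 < e₀ - x by linarith)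
    exact (hsl 0 x (by rw [abs_zero, add_zero]; linarith)).2.2.1
  -- the defect density splits
  have hDt : ∀ x < e₀, deriv (fun τ => ψ τ x - p τ x) 0 = -deriv (fun τ => p τ x) 0 := by
    intro x hx
    rw [((hψt x).fun_sub (hpt x hx)).deriv, zero_sub]
  have hDx : ∀ x < e₀, deriv (fun y => ψ 0 y - p 0 y) x = deriv g x - deriv (p 0) x := by
    intro x hx
    rw [hψ0]
    exact ((hgd x).fun_sub (hpx x hx)).deriv
  -- finiteness of the near energy of `p` at `t = 0`
  set G : ℝ → ℝ := fun x => deriv g x ^ 2 + V x * g x ^ 2 with hG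
  have hGc : Continuous G := by
    simp only [hG]
    exact (hgc'.pow 2).add (hV.continuous.mul (hg.continuous.pow 2))
  have hG0 : ∀ x, 0 ≤ G x := fun x => by
    simp only [hG]; nlinarith [sq_nonneg (deriv g x), mul_nonneg (hV0 x) (sq_nonneg (g x))]
  have hGsupp : HasCompactSupport G := by
    have h1 : HasCompactSupport (fun x => deriv g x * deriv g x) := hgc.deriv.mul_right
    have h2 : HasCompactSupport (fun x => (V x * g x) * g x) := hgc.mul_left
    have : G = fun x => deriv g x * deriv g x + (V x * g x) * g x := by
      funext x; simp only [hG]; ring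
    rw [this]
    exact h1.add h2
  have hGint : ∫⁻ x in Iio e₀, ENNReal.ofReal (G x) < ⊤ :=
    lt_of_le_of_lt (setLIntegral_le_lintegral _ _)
      (hGc.integrable_of_hasCompactSupport hGsupp).lintegral_lt_top
  have hfinp : ∫⁻ x in Iio e₀, ENNReal.ofReal
      (deriv (fun τ => p τ x) 0 ^ 2 + deriv (p 0) x ^ 2 + V x * p 0 x ^ 2) < ⊤ := by
    have hptw : ∀ x ∈ Iio e₀, ENNReal.ofReal
        (deriv (fun τ => p τ x) 0 ^ 2 + deriv (p 0) x ^ 2 + V x * p 0 x ^ 2)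
        ≤ ENNReal.ofReal (2 * (deriv (fun τ => ψ τ x - p τ x) 0 ^ 2
            + deriv (fun y => ψ 0 y - p 0 y) x ^ 2 + V x * (ψ 0 x - p 0 x) ^ 2))
          + ENNReal.ofReal (2 * G x) := by
      intro x hx
      have hnn : 0 ≤ 2 * (deriv (fun τ => ψ τ x - p τ x) 0 ^ 2
          + deriv (fun y => ψ 0 y - p 0 y) x ^ 2 + V x * (ψ 0 x - p 0 x) ^ 2) :=
        mul_nonneg zero_le_two (add_nonneg (add_nonneg (sq_nonneg _) (sq_nonneg _))
          (mul_nonneg (hV0 x) (sq_nonneg _)))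
      rw [← ENNReal.ofReal_add hnn (by linarith [hG0 x])]
      refine ENNReal.ofReal_le_ofReal ?_
      rw [hDt x hx, hDx x hx, h0 x]
      simp only [hG]
      nlinarith [sq_nonneg (2 * deriv g x - deriv (p 0) x), sq_nonneg (deriv (fun τ => p τ x) 0),
        mul_nonneg (hV0 x) (sq_nonneg (2 * g x - p 0 x))]
    refine lt_of_le_of_lt (setLIntegral_mono' measurableSet_Iio hptw) ?_
    have hmeasG : Measurable fun x => ENNReal.ofReal (2 * G x) :=
      ENNReal.measurable_ofReal.comp (measurable_const.mul hGc.measurable)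
    rw [lintegral_add_right _ hmeasG]
    refine ENNReal.add_lt_top.mpr ⟨?_, ?_⟩
    · have : (fun x => ENNReal.ofReal (2 * (deriv (fun τ => ψ τ x - p τ x) 0 ^ 2
          + deriv (fun y => ψ 0 y - p 0 y) x ^ 2 + V x * (ψ 0 x - p 0 x) ^ 2)))
          = fun x => ENNReal.ofReal 2 * ENNReal.ofReal (deriv (fun τ => ψ τ x - p τ x) 0 ^ 2
            + deriv (fun y => ψ 0 y - p 0 y) x ^ 2 + V x * (ψ 0 x - p 0 x) ^ 2) :=
        funext fun x => ENNReal.ofReal_mul (by norm_num)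
      rw [this, lintegral_const_mul' _ _ ENNReal.ofReal_ne_top]
      exact ENNReal.mul_lt_top ENNReal.ofReal_lt_top (lt_top_iff_ne_top.mpr hinf)
    · have : (fun x => ENNReal.ofReal (2 * G x)) = fun x => ENNReal.ofReal 2 * ENNReal.ofReal (G x) :=
        funext fun x => ENNReal.ofReal_mul (by norm_num)
      rw [this, lintegral_const_mul' _ _ ENNReal.ofReal_ne_top]
      exact ENNReal.mul_lt_top ENNReal.ofReal_lt_top hGint
  -- the census: `p` is static on the near cone
  have hstat := static_of_finite_energy hV hV0 hκ hC hVexp hp hsol ⟨N, a, ha⟩ hfinp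
  have hpt0 : ∀ x < e₀, deriv (fun τ => p τ x) 0 = 0 := by
    intro x hx
    have hO : IsOpen {τ : ℝ | x + |τ| < e₀} := isOpen_lt (by fun_prop) continuous_const
    have hx0 : x + |(0 : ℝ)| < e₀ := by simpa using hx
    have hev : (fun τ => p τ x) =ᶠ[𝓝 0] fun _ => p 0 x := by
      filter_upwards [hO.mem_nhds hx0] with τ hτ
      exact hstat (τ, x) hτ
    rw [hev.deriv_eq, deriv_const]
  have hptt0 : ∀ x < e₀, iteratedDeriv 2 (fun τ => p τ x) 0 = 0 := by
    intro x hx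
    have hO : IsOpen {τ : ℝ | x + |τ| < e₀} := isOpen_lt (by fun_prop) continuous_const
    have hx0 : x + |(0 : ℝ)| < e₀ := by simpa using hx
    have hev : (fun τ => p τ x) =ᶠ[𝓝 0] fun _ => p 0 x := by
      filter_upwards [hO.mem_nhds hx0] with τ hτ
      exact hstat (τ, x) hτ
    rw [hev.iteratedDeriv_eq 2, iteratedDeriv_const]
    simp
  have hpxx : ∀ x < e₀, iteratedDeriv 2 (p 0) x = V x * p 0 x := by
    intro x hx
    have h := hsol (0, x) (by simpa using hx)
    simp only [hptt0 x hx] at h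
    linarith
  -- the continuous representative on `[s₁, s₂]` through the extension `u`
  obtain ⟨u, hu, hsl⟩ := exists_extension_slices hp (show 0 < e₀ - s₂ by linarith)
  have hgood : ∀ y ≤ s₂, y + |(0 : ℝ)| < e₀ - (e₀ - s₂) / 2 := fun y hy => by
    rw [abs_zero, add_zero]; linarith
  set q : ℝ → ℝ := fun y => u (0, y) with hq
  set q' : ℝ → ℝ := fun y => fderiv ℝ u (0, y) (0, 1) with hq'
  set q'' : ℝ → ℝ := fun y => fderiv ℝ (fderiv ℝ u) (0, y) (0, 1) (0, 1) with hq''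
  have hqd : ∀ y, HasDerivAt q (q' y) y := fun y => hasDerivAt_slice_snd (differentiable_of_contDiff_two hu) 0 y
  have hq'd : ∀ y, HasDerivAt q' (q'' y) y := fun y => hasDerivAt_fderiv_apply_slice_snd hu (0, 1) 0 y
  have hq''c : Continuous q'' := by
    have hc := (hu.fderiv_right (m := 1) (by norm_num)).continuous_fderiv (by norm_num)
    exact ((hc.clm_apply continuous_const).clm_apply continuous_const).comp (Continuous.prodMk_right 0)
  have hq'c : Continuous q' := (continuous_fderiv_apply hu (0, 1)).comp (Continuous.prodMk_right 0)
  have hqc : Continuous q := hu.continuous.comp (Continuous.prodMk_right 0)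
  -- identification with `p 0` and its derivatives on `(-∞, s₂]`
  have hidq : ∀ y ≤ s₂, p 0 y = q y := fun y hy => (hsl 0 y (hgood y hy)).2.1
  have hidq' : ∀ y ≤ s₂, deriv (p 0) y = q' y := by
    intro y hy
    have h3 := (hsl 0 y (hgood y hy)).2.2.1
    -- `p 0` agrees with `q` near `y`
    have hO : IsOpen {w : ℝ | w < e₀ - (e₀ - s₂) / 2} := isOpen_Iio
    have hev : p 0 =ᶠ[𝓝 y] q := by
      filter_upwards [hO.mem_nhds (show y < e₀ - (e₀ - s₂) / 2 by linarith)] with w hw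
      exact (hsl 0 w (by rw [abs_zero, add_zero]; exact hw)).2.1
    rw [hev.deriv_eq, (hqd y).deriv]
  have hidq'' : ∀ y ≤ s₂, q'' y = V y * q y := by
    intro y hy
    have hO : IsOpen {w : ℝ | w < e₀ - (e₀ - s₂) / 2} := isOpen_Iio
    have hev : p 0 =ᶠ[𝓝 y] q := by
      filter_upwards [hO.mem_nhds (show y < e₀ - (e₀ - s₂) / 2 by linarith)] with w hw
      exact (hsl 0 w (by rw [abs_zero, add_zero]; exact hw)).2.1
    have h1 := hpxx y (by linarith)
    rw [hev.iteratedDeriv_eq 2, hidq y hy] at h1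
    rw [← h1, iteratedDeriv_succ, iteratedDeriv_one]
    have hdq : deriv q = q' := funext fun w => (hqd w).deriv
    rw [hdq, (hq'd y).deriv]
  -- the continuous density `D̃` and its interval integral
  set D : ℝ → ℝ := fun y => (deriv g y - q' y) ^ 2 + V y * (g y - q y) ^ 2 with hD
  have hDc : Continuous D := by
    simp only [hD]
    exact ((hgc'.sub hq'c).pow 2).add (hV.continuous.mul ((hg.continuous.sub hqc).pow 2))
  have hD0 : ∀ y, 0 ≤ D y := fun y => by
    simp only [hD]; nlinarith [sq_nonneg (deriv g y - q' y), mul_nonneg (hV0 y) (sq_nonneg (g y - q y))]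
  have hDeq : ∀ y ∈ Ioc s₁ s₂, ENNReal.ofReal
      (deriv (fun τ => ψ τ y - p τ y) 0 ^ 2 + deriv (fun w => ψ 0 w - p 0 w) y ^ 2
        + V y * (ψ 0 y - p 0 y) ^ 2) = ENNReal.ofReal (D y) := by
    intro y hy
    have hye : y < e₀ := lt_of_le_of_lt hy.2 hs₂
    rw [hDt y hye, hpt0 y hye, hDx y hye, h0 y, hidq y hy.2, hidq' y hy.2]
    simp [hD]
  -- integration by parts: the cross term vanishes
  have hparts : ∫ y in s₁..s₂, q' y * deriv g y = -∫ y in s₁..s₂, q'' y * g y := by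
    rw [integral_mul_deriv_eq_deriv_mul (fun y _ => hq'd y) (fun y _ => hgd y)
      (hq''c.intervalIntegrable _ _) (hgc'.intervalIntegrable _ _), hg₁, hg₂]
    ring
  have i1 : IntervalIntegrable (fun y => q' y * deriv g y) volume s₁ s₂ := by
    exact (hq'c.mul hgc').intervalIntegrable _ _
  have i2 : IntervalIntegrable (fun y => V y * g y * q y) volume s₁ s₂ := by
    exact ((hV.continuous.mul hg.continuous).mul hqc).intervalIntegrable _ _
  have hcross : ∫ y in s₁..s₂, (q' y * deriv g y + V y * g y * q y) = 0 := by
    have h3 : ∫ y in s₁..s₂, q'' y * g y = ∫ y in s₁..s₂, V y * g y * q y :=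
      intervalIntegral.integral_congr fun y hy => by
        rw [uIcc_of_le hs] at hy
        rw [hidq'' y hy.2]
        ring
    rw [intervalIntegral.integral_add i1 i2, hparts, h3]
    ring
  have hlow : ∫ y in s₁..s₂, G y ≤ ∫ y in s₁..s₂, D y := by
    have hsplit : ∀ y, D y = (G y - 2 * (q' y * deriv g y + V y * g y * q y))
        + (q' y ^ 2 + V y * q y ^ 2) := by
      intro y; simp only [hD, hG]; ring
    have iG : IntervalIntegrable (fun y => G y) volume s₁ s₂ := by
      exact hGc.intervalIntegrable _ _
    have iK : IntervalIntegrable (fun y => 2 * (q' y * deriv g y + V y * g y * q y)) volume s₁ s₂ := by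
      exact (continuous_const.mul ((hq'c.mul hgc').add
        ((hV.continuous.mul hg.continuous).mul hqc))).intervalIntegrable _ _
    have iGK : IntervalIntegrable (fun y => G y - 2 * (q' y * deriv g y + V y * g y * q y)) volume s₁ s₂ :=
      iG.sub iK
    have iQ : IntervalIntegrable (fun y => q' y ^ 2 + V y * q y ^ 2) volume s₁ s₂ := by
      exact ((hq'c.pow 2).add (hV.continuous.mul (hqc.pow 2))).intervalIntegrable _ _
    have h1 : ∫ y in s₁..s₂, D y = (∫ y in s₁..s₂, (G y - 2 * (q' y * deriv g y + V y * g y * q y)))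
        + ∫ y in s₁..s₂, (q' y ^ 2 + V y * q y ^ 2) := by
      rw [← intervalIntegral.integral_add iGK iQ]
      exact intervalIntegral.integral_congr fun y _ => hsplit y
    have h2 : ∫ y in s₁..s₂, (G y - 2 * (q' y * deriv g y + V y * g y * q y))
        = ∫ y in s₁..s₂, G y := by
      have h21 := intervalIntegral.integral_sub iG iK
      have h22 : ∫ y in s₁..s₂, 2 * (q' y * deriv g y + V y * g y * q y) = 0 := by
        rw [intervalIntegral.integral_const_mul, hcross, mul_zero]
      rw [h21, h22, sub_zero]
    have h3 : 0 ≤ ∫ y in s₁..s₂, (q' y ^ 2 + V y * q y ^ 2) :=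
      intervalIntegral.integral_nonneg hs fun y _ => by
        nlinarith [sq_nonneg (q' y), mul_nonneg (hV0 y) (sq_nonneg (q y))]
    linarith
  -- assemble
  calc ENNReal.ofReal (∫ x in s₁..s₂, deriv g x ^ 2 + V x * g x ^ 2)
      ≤ ENNReal.ofReal (∫ y in s₁..s₂, D y) := ENNReal.ofReal_le_ofReal hlow
    _ = ∫⁻ y in Ioc s₁ s₂, ENNReal.ofReal (D y) :=
        (lintegral_Ioc_eq_ofReal_intervalIntegral hDc hD0 hs).symm
    _ = ∫⁻ y in Ioc s₁ s₂, ENNReal.ofReal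
          (deriv (fun τ => ψ τ y - p τ y) 0 ^ 2 + deriv (fun w => ψ 0 w - p 0 w) y ^ 2
            + V y * (ψ 0 y - p 0 y) ^ 2) :=
        (setLIntegral_congr_fun measurableSet_Ioc hDeq).symm
    _ ≤ _ := lintegral_mono_set fun y hy => lt_of_le_of_lt hy.2 hs₂

end KernelCensus

end

end Summit.FinalStateConjecture.FinalStateConjecture.Theorems
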